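import Mathlib.Analysis.SpecialFunctions.Complex.LogBounds
import Literature.NumberTheory.Transcendental.DiazEstimates
import Literature.NumberTheory.Transcendental.DiazZeroLemma
import HarnessLib

/-!
# Diaz 1989, Théorème 1 — §II-3-4: the family `{Q_{μj}}` has no zero in the ball `𝓑_ρ`

Topic `Literature/NumberTheory/Transcendental` (trunk T-TRANSCEND). Decomposition step for the
named fact `Literature.NumberTheory.Transcendental.Diaz1989_thm1` (`DiazMain.lean`): §II-3-4 of G. Diaz, J. Number
Theory 31 (1989), pp. 11–14, "Application du lemme de zéros". For a point `θ̃` of the ball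
`𝓑_ρ` (`max |θ̃ᵢ - θᵢ| ≤ e^{-ρ}`) and its minimal index `j = j(θ̃)`, one writes `θ̃_hk = e^{z_hk}`
with `z_hk` close to `u_hv_k` (a continuity argument, here via the principal logarithm), forms the
nonzero polynomial `P̃(W) = ∑ P_{dλj}(θ̃) W₀^d W^λ ∈ ℂ[W]` and observes (13):
`Q_{μj}(θ̃) = P̃(∑ μ_kθ̃_k, ∏_k e^{z_1kμ_k}, …, ∏_k e^{z_nkμ_k})`. If all `Q_{μj}(θ̃)`, `|μ| < M₁`,
vanished, the zero lemma (`Diaz1989_zeroLemma`, with `S = M₁ - 1`, `D₀ = D - 1`, `D₁ = L - 1`)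
would produce small `λ ≠ 0`, `μ ≠ 0` with `|λ.u|·|μ.v|` tiny — which the technical hypothesis
(HT1) forbids for the chosen parameters (that last step, (𝒞9), is done in the sequel). Here:

* `zlog`, `exp_zlog`, `norm_zlog_sub_le` — the logarithms `z_hk`;
* `Ptilde`, `Ptilde_ne_zero`, `degreeOf_Ptilde_zero_le`, `degreeOf_Ptilde_succ_le`;
* `eval_Ptilde_eq` — the identity (13);
* `ZeroLemmaAt`, `exists_zeroLemmaAt` (the zero lemma at a fixed constant `c(n)`) and
  `exists_aeval_Qj_ne_zero_or` — the contrapositive packaging: under the hypotheses (10), (11) of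
  the zero lemma, either some `Q_{μj}(θ̃) ≠ 0` (`|μ| < M₁`) or there is a small pair `(λ, μ)` as
  in (12).

Everything here is proved (the zero lemma enters as the hypothesis `(hZ : Diaz1989_zeroLemma)`).

## References

* G. Diaz, *Grands degrés de transcendance pour des familles d'exponentielles*, J. Number Theory
  31 (1989), 1–23, §II-3-4, pp. 11–14.
-/

noncomputable section

open MvPolynomial Finset Finsupp

namespace Literature.NumberTheory.Transcendental

namespace DiazThm1

variable {m n D L M : ℕ}

/-! ### The logarithms `z_hk` -/

/-- `z_hk = u_hv_k + log(θ̃_hk e^{-u_hv_k})` (principal logarithm), so that `e^{z_hk} = θ̃_hk`.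
[cite: Diaz1989, §II-3-4 p. 12 (un argument de continuité)] -/
def zlog (u : Fin n → ℂ) (v : Fin m → ℂ) (θ' : Var m n → ℂ) (h : Fin n) (k : Fin m) : ℂ :=
  u h * v k + Complex.log (θ' (Sum.inr (h, k)) * Complex.exp (-(u h * v k)))

/-- `e^{z_hk} = θ̃_hk` as soon as `θ̃_hk ≠ 0`. [folklore] -/
theorem exp_zlog (u : Fin n → ℂ) (v : Fin m → ℂ) {θ' : Var m n → ℂ} (h : Fin n) (k : Fin m)
    (hne : θ' (Sum.inr (h, k)) ≠ 0) : Complex.exp (zlog u v θ' h k) = θ' (Sum.inr (h, k)) := by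
  unfold zlog
  rw [Complex.exp_add, Complex.exp_log (mul_ne_zero hne (Complex.exp_ne_zero _)), mul_left_comm,
    ← Complex.exp_add, add_neg_cancel, Complex.exp_zero, mul_one]

/-- `|z_hk - u_hv_k| ≤ (3/2) |θ̃_hk - e^{u_hv_k}| · |e^{-u_hv_k}|` when the right-hand side factor
`|θ̃_hk - e^{u_hv_k}| · |e^{-u_hv_k}| ≤ 1/2`. [folklore] -/
theorem norm_zlog_sub_le (u : Fin n → ℂ) (v : Fin m → ℂ) {θ' : Var m n → ℂ} (h : Fin n) (k : Fin m)
    (hsmall : ‖θ' (Sum.inr (h, k)) - Complex.exp (u h * v k)‖ * ‖Complex.exp (-(u h * v k))‖ ≤ 1 / 2) :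
    ‖zlog u v θ' h k - u h * v k‖ ≤
      3 / 2 * (‖θ' (Sum.inr (h, k)) - Complex.exp (u h * v k)‖ * ‖Complex.exp (-(u h * v k))‖) := by
  set w : ℂ := θ' (Sum.inr (h, k)) * Complex.exp (-(u h * v k)) - 1 with hw
  have hw' : w = (θ' (Sum.inr (h, k)) - Complex.exp (u h * v k)) * Complex.exp (-(u h * v k)) := by
    rw [hw, sub_mul, ← Complex.exp_add, add_neg_cancel, Complex.exp_zero]
  have hnw : ‖w‖ = ‖θ' (Sum.inr (h, k)) - Complex.exp (u h * v k)‖ * ‖Complex.exp (-(u h * v k))‖ := by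
    rw [hw', norm_mul]
  have h1 : zlog u v θ' h k - u h * v k = Complex.log (1 + w) := by
    unfold zlog
    rw [hw]
    ring_nf
  rw [h1, ← hnw]
  exact Complex.norm_log_one_add_half_le_self (by rw [hnw]; exact hsmall)

/-! ### The polynomial `P̃` and the identity (13) -/

/-- The monomial exponent `(d ; λ₁, …, λ_n)` of `W₀^d W^λ`. [folklore] -/
def expW (a : DL n D L) : Fin (n + 1) →₀ ℕ :=
  equivFunOnFinite.symm (Fin.cons (a.1 : ℕ) fun h => (a.2 h : ℕ))

/-- The `W₀`-exponent of `expW a` is `d`. [folklore] -/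
@[simp] theorem expW_zero (a : DL n D L) : expW a 0 = (a.1 : ℕ) := by
  simp [expW]

/-- The `W_h`-exponent of `expW a` is `λ_h`. [folklore] -/
@[simp] theorem expW_succ (a : DL n D L) (h : Fin n) : expW a h.succ = (a.2 h : ℕ) := by
  simp [expW]

/-- `expW` is injective. [folklore] -/
theorem expW_injective : Function.Injective (expW : DL n D L → Fin (n + 1) →₀ ℕ) := by
  rintro ⟨d, lam⟩ ⟨d', lam'⟩ hEq
  have h0 : d = d' := Fin.ext (by simpa using congrArg (fun f => f 0) hEq)
  have h1 : lam = lam' := funext fun h => Fin.ext (by simpa using congrArg (fun f => f h.succ) hEq)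
  rw [h0, h1]

/-- **`P̃(W) = ∑_{d,λ} P_{dλj}(θ̃) W₀^d W^λ ∈ ℂ[W₀, …, W_n]`** (Diaz 1989, p. 13).
[cite: Diaz1989, §II-3-4 p. 13] -/
def Ptilde (p : Unk m n D L M → ℤ) (j : Var m n →₀ ℕ) (θ' : Var m n → ℂ) :
    MvPolynomial (Fin (n + 1)) ℂ :=
  ∑ a : DL n D L, monomial (expW a) (aeval θ' (Pj p a j))

/-- The coefficient of `W₀^dW^λ` in `P̃` is `P_{dλj}(θ̃)`. [folklore] -/
theorem coeff_expW_Ptilde (p : Unk m n D L M → ℤ) (j : Var m n →₀ ℕ) (θ' : Var m n → ℂ)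
    (a : DL n D L) : coeff (expW a) (Ptilde p j θ') = aeval θ' (Pj p a j) := by
  classical
  unfold Ptilde
  rw [coeff_sum, Finset.sum_eq_single a]
  · rw [coeff_monomial, if_pos rfl]
  · intro a' _ hne
    rw [coeff_monomial, if_neg fun h => hne (expW_injective h)]
  · intro h
    exact absurd (Finset.mem_univ a) h

/-- **`P̃ ≠ 0`** when `j` is a minimal index at `θ̃` ("ce polynôme est non nul car, par
construction, un des `P_{dλj}(θ̃)` est non nul", p. 13). [cite: Diaz1989, §II-3-4 p. 13] -/
theorem Ptilde_ne_zero {p : Unk m n D L M → ℤ} {j : Var m n →₀ ℕ} {θ' : Var m n → ℂ}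
    (hj : IsMinIdx p θ' j) : Ptilde p j θ' ≠ 0 := by
  obtain ⟨a, ha⟩ := hj.1
  intro h0
  apply ha
  rw [← coeff_expW_Ptilde p j θ' a, h0, coeff_zero]

/-- `deg_{W₀} P̃ ≤ D - 1`. [cite: Diaz1989, §II-3-4 p. 13 (D₀ = D - 1)] -/
theorem degreeOf_Ptilde_zero_le (p : Unk m n D L M → ℤ) (j : Var m n →₀ ℕ) (θ' : Var m n → ℂ) :
    degreeOf 0 (Ptilde p j θ') ≤ D - 1 := by
  classical
  unfold Ptilde
  refine (degreeOf_sum_le _ _ _).trans (Finset.sup_le fun a _ => ?_)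
  rw [degreeOf_le_iff]
  intro e he
  have : e = expW a := by simpa using support_monomial_subset he
  subst this
  have := a.1.isLt
  simp only [expW_zero]
  omega

/-- `deg_{W_h} P̃ ≤ L - 1`. [cite: Diaz1989, §II-3-4 p. 13 (D₁ = L - 1)] -/
theorem degreeOf_Ptilde_succ_le (p : Unk m n D L M → ℤ) (j : Var m n →₀ ℕ) (θ' : Var m n → ℂ)
    (h : Fin n) : degreeOf h.succ (Ptilde p j θ') ≤ L - 1 := by
  classical
  unfold Ptilde
  refine (degreeOf_sum_le _ _ _).trans (Finset.sup_le fun a _ => ?_)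
  rw [degreeOf_le_iff]
  intro e he
  have : e = expW a := by simpa using support_monomial_subset he
  subst this
  have := (a.2 h).isLt
  simp only [expW_succ]
  omega

/-- The point `(∑ μ_kθ̃_k, ∏_k e^{z_1kμ_k}, …, ∏_k e^{z_nkμ_k})` at which `P̃` is evaluated.
[cite: Diaz1989, §II-3-4 (13) p. 13] -/
def zpoint (u : Fin n → ℂ) (v : Fin m → ℂ) (θ' : Var m n → ℂ) (μ : Fin m → ℕ) : Fin (n + 1) → ℂ :=
  Fin.cons (∑ k, (μ k : ℂ) * θ' (Sum.inl k))
    fun h => ∏ k, Complex.exp (zlog u v θ' h k * (μ k : ℂ))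

/-- **The identity (13)**: `Q_{μj}(θ̃) = P̃(∑ μ_kθ̃_k, ∏ e^{z_1kμ_k}, …, ∏ e^{z_nkμ_k})`, provided all
`θ̃_hk ≠ 0` (so that `θ̃_hk = e^{z_hk}`). [cite: Diaz1989, §II-3-4 (13) p. 13] -/
theorem eval_Ptilde_eq (u : Fin n → ℂ) (v : Fin m → ℂ) (p : Unk m n D L M → ℤ)
    (j : Var m n →₀ ℕ) {θ' : Var m n → ℂ} (hne : ∀ h k, θ' (Sum.inr (h, k)) ≠ 0) (μ : Fin m → ℕ) :
    MvPolynomial.eval (zpoint u v θ' μ) (Ptilde p j θ') = aeval θ' (Qj p μ j) := by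
  classical
  unfold Ptilde Qj
  rw [map_sum, map_sum]
  refine Finset.sum_congr rfl fun a _ => ?_
  rw [eval_monomial, map_mul]
  congr 1
  -- `R_{dλμ}(θ̃) = (∑ μ_kθ̃_k)^d ∏_{h,k} θ̃_hk^{λ_hμ_k}`
  rw [Rfac, map_mul, map_pow, Finsupp.prod_fintype _ _ (fun i => by simp), Fin.prod_univ_succ]
  simp only [zpoint, Fin.cons_zero, Fin.cons_succ, expW_zero, expW_succ]
  congr 1
  · unfold linForm
    simp [map_sum]
  · rw [aeval_monomial, map_one, one_mul, Finsupp.prod_fintype _ _ (fun i => by simp),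
      Fintype.prod_sum_type]
    simp only [lamMu_inl, pow_zero, Finset.prod_const_one, one_mul, lamMu_inr]
    rw [Fintype.prod_prod_type]
    refine Finset.prod_congr rfl fun h _ => ?_
    rw [← Finset.prod_pow]
    refine Finset.prod_congr rfl fun k _ => ?_
    rw [← Complex.exp_nat_mul, ← exp_zlog u v h k (hne h k), ← Complex.exp_nat_mul]
    congr 1
    push_cast
    ring

/-! ### The zero lemma applied -/

/-- The zero lemma at a fixed `n` with a fixed constant `c` (the body of `Diaz1989_zeroLemma`).
[cite: Diaz1989, §II-3-4 Lemme de zéros, pp. 11–12] -/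
def ZeroLemmaAt (n : ℕ) (hn : 1 ≤ n) (c : ℝ) : Prop :=
    ∀ (m : ℕ), 2 ≤ m →
    ∀ (S V D₀ D₁ Δ : ℝ), 0 < S → 0 < V → 0 < D₀ → 0 < D₁ → 0 < Δ →
    ∀ (u : Fin n → ℂ) (v : Fin m → ℂ), LinearIndependent ℚ u → LinearIndependent ℚ v →
    ∀ (θ : Fin m → ℂ) (z : Fin n → Fin m → ℂ),
      (∑ h, ∑ k, ‖z h k - u h * v k‖) < Real.exp (-V) →
      (∑ k, ‖θ k - v k‖) < Real.exp (-V) →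
      (∑ h, ∑ k, ‖z h k‖) ≤ Δ → Real.pi * ‖u ⟨0, hn⟩‖ ≤ Δ → Real.pi ≤ Δ →
    ∀ (P : MvPolynomial (Fin (n + 1)) ℂ), P ≠ 0 →
      (P.degreeOf 0 : ℝ) ≤ D₀ → (∀ h : Fin n, (P.degreeOf h.succ : ℝ) ≤ D₁) →
      (∀ μ : Fin m → ℕ, (∀ k, (μ k : ℝ) < S + 1) →
        MvPolynomial.eval (Fin.cons (∑ k, (μ k : ℂ) * θ k)
          (fun h => ∏ k, Complex.exp (z h k * (μ k : ℂ)))) P = 0) →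
      1 ≤ D₀ → 1 ≤ D₁ →
      ((n + 1).factorial : ℝ) * D₀ * D₁ ^ n < (S / (n + 1)) ^ m →
      (n + 1 : ℝ) * D₁ < (S / (n + 1)) ^ (m - 1) →
      ∃ (lam : Fin n → ℤ) (mu : Fin m → ℤ), lam ≠ 0 ∧ mu ≠ 0 ∧
        (∀ i, (|lam i| : ℝ) ≤ c * Δ * D₁ ^ 2 * (S / (n + 1))) ∧
        (∀ k, (|mu k| : ℝ) ≤ c * Δ * D₁ * (S / (n + 1)) ^ 2) ∧
        ‖∑ i, (lam i : ℂ) * u i‖ * ‖∑ k, (mu k : ℂ) * v k‖ ≤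
          c * Δ * D₁ ^ 2 * (S / (n + 1)) ^ 2 * Real.exp (-V)

/-- `Diaz1989_zeroLemma` provides, for each `n ≥ 1`, a constant `c > 0` with `ZeroLemmaAt n hn c`.
[cite: Diaz1989, §II-3-4 Lemme de zéros, pp. 11–12] -/
theorem exists_zeroLemmaAt (hZ : Diaz1989_zeroLemma) (n : ℕ) (hn : 1 ≤ n) :
    ∃ c : ℝ, 0 < c ∧ ZeroLemmaAt n hn c :=
  hZ n hn

/-- **§II-3-4, the alternative.** Let `j` be a minimal index at `θ̃`, all `θ̃_hk ≠ 0`, and let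
`V, Δ` satisfy the hypotheses (10) of the zero lemma for `θ_k = θ̃_k`, `z_hk = zlog u v θ̃ h k`;
let `D, L ≥ 2`, `M₁ ≥ 2` satisfy (11) with `S = M₁ - 1`, `D₀ = D - 1`, `D₁ = L - 1`. Then either some
`Q_{μj}(θ̃) ≠ 0` with `|μ| < M₁`, or there is a pair `(λ, μ) ≠ (0, 0)` as in (12). (Diaz, p. 14: "Les
conditions (10) et (11) du lemme de zéros sont remplies, mais pas la conclusion. Donc le polynôme
`P̃` ne s'annule pas sur tous les points considérés.")
[cite: Diaz1989, §II-3-4 pp. 12–14] -/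
theorem exists_aeval_Qj_ne_zero_or (hn : 1 ≤ n) (hm : 2 ≤ m) {c : ℝ} (hZc : ZeroLemmaAt n hn c)
    (u : Fin n → ℂ) (v : Fin m → ℂ) (hu : LinearIndependent ℚ u) (hv : LinearIndependent ℚ v)
    (p : Unk m n D L M → ℤ) {j : Var m n →₀ ℕ} {θ' : Var m n → ℂ} (hj : IsMinIdx p θ' j)
    (hne : ∀ h k, θ' (Sum.inr (h, k)) ≠ 0) {V Δ : ℝ} (hV : 0 < V) (hΔ : 0 < Δ)
    (h10a : (∑ h, ∑ k, ‖zlog u v θ' h k - u h * v k‖) < Real.exp (-V))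
    (h10b : (∑ k, ‖θ' (Sum.inl k) - v k‖) < Real.exp (-V))
    (h10c : (∑ h, ∑ k, ‖zlog u v θ' h k‖) ≤ Δ) (h10d : Real.pi * ‖u ⟨0, hn⟩‖ ≤ Δ)
    (h10e : Real.pi ≤ Δ) (hD : 2 ≤ D) (hL : 2 ≤ L) {M₁ : ℕ} (hM₁ : 2 ≤ M₁)
    (h11a : ((n + 1).factorial : ℝ) * ((D - 1 : ℕ) : ℝ) * ((L - 1 : ℕ) : ℝ) ^ n <
      (((M₁ - 1 : ℕ) : ℝ) / (n + 1)) ^ m)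
    (h11b : (n + 1 : ℝ) * ((L - 1 : ℕ) : ℝ) < (((M₁ - 1 : ℕ) : ℝ) / (n + 1)) ^ (m - 1)) :
    (∃ μ : Fin m → ℕ, (∀ k, μ k < M₁) ∧ aeval θ' (Qj p μ j) ≠ 0) ∨
    ∃ (lam : Fin n → ℤ) (mu : Fin m → ℤ), lam ≠ 0 ∧ mu ≠ 0 ∧
      (∀ i, (|lam i| : ℝ) ≤ c * Δ * ((L - 1 : ℕ) : ℝ) ^ 2 * (((M₁ - 1 : ℕ) : ℝ) / (n + 1))) ∧
      (∀ k, (|mu k| : ℝ) ≤ c * Δ * ((L - 1 : ℕ) : ℝ) * (((M₁ - 1 : ℕ) : ℝ) / (n + 1)) ^ 2) ∧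
      ‖∑ i, (lam i : ℂ) * u i‖ * ‖∑ k, (mu k : ℂ) * v k‖ ≤
        c * Δ * ((L - 1 : ℕ) : ℝ) ^ 2 * (((M₁ - 1 : ℕ) : ℝ) / (n + 1)) ^ 2 * Real.exp (-V) := by
  classical
  by_cases hex : ∃ μ : Fin m → ℕ, (∀ k, μ k < M₁) ∧ aeval θ' (Qj p μ j) ≠ 0
  · exact Or.inl hex
  right
  push Not at hex
  have hS : (0 : ℝ) < ((M₁ - 1 : ℕ) : ℝ) := by
    have : (1 : ℕ) ≤ M₁ - 1 := by omega
    exact_mod_cast this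
  have hD₀ : (0 : ℝ) < ((D - 1 : ℕ) : ℝ) := by
    have : (1 : ℕ) ≤ D - 1 := by omega
    exact_mod_cast this
  have hD₁ : (0 : ℝ) < ((L - 1 : ℕ) : ℝ) := by
    have : (1 : ℕ) ≤ L - 1 := by omega
    exact_mod_cast this
  refine hZc m hm _ V _ _ Δ hS hV hD₀ hD₁ hΔ u v hu hv (fun k => θ' (Sum.inl k)) (zlog u v θ')
    h10a h10b h10c h10d h10e (Ptilde p j θ') (Ptilde_ne_zero hj) ?_ ?_ ?_ ?_ ?_ h11a h11b
  · exact_mod_cast degreeOf_Ptilde_zero_le p j θ'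
  · intro h
    exact_mod_cast degreeOf_Ptilde_succ_le p j θ' h
  · intro μ hμ
    have hμ' : ∀ k, μ k < M₁ := fun k => by
      have := hμ k
      have h1 : ((M₁ - 1 : ℕ) : ℝ) + 1 = M₁ := by
        have : ((M₁ - 1 : ℕ) : ℝ) = M₁ - 1 := by
          rw [Nat.cast_sub (by omega)]
          simp
        rw [this]; ring
      rw [h1] at this
      exact_mod_cast this
    have := eval_Ptilde_eq u v p j hne μ
    rw [hex μ hμ'] at this
    exact this
  · have : (1 : ℕ) ≤ D - 1 := by omega
    exact_mod_cast this
  · have : (1 : ℕ) ≤ L - 1 := by omega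
    exact_mod_cast this

end DiazThm1


end Literature.NumberTheory.Transcendental

end
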